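import Literature.MathematicalPhysics.KineticTheory.TaggedSphereOneStepLevels
import Literature.MathematicalPhysics.KineticTheory.HardSphereBBGKYLiouvilleEstimate
import HarnessLib

/-!
# The one-step BBGKY hierarchy almost everywhere from its weak form along the tagged flow
(Cercignani–Illner–Pulvirenti 1994 §4.3 (4.3.9)–(4.3.10), Thm 4.3.1; Bodineau–Gallagher–Saint-Raymond
2016 §3.1 p. 9, (4.3) p. 11; trunk T-KINETIC, topic MathematicalPhysics/KineticTheory; a reduction
layer for the named fact `Literature.MathematicalPhysics.KineticTheory.bgsr_linearBoltzmannApprox`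
of `TaggedSphereDiffusion`.)

The derivation of the BBGKY hierarchy from the Liouville dynamics (CIP 1994 Thm 4.3.1, App. 4.B;
in the tree `HardSphereBBGKYLiouvilleEstimate.setIntegral_marginal_flow_eq`,
`HardSphereMildBBGKY`, `HardSphereMildBBGKYOneStepWeak.weak_identity`) produces the hierarchy in
WEAK form along the tagged flow: for measurable sets `B` of good `k`-configurations,
`∫_B u_k(t, Φ^k_t Y) dY - ∫_B u_k(0, Y) dY = ∫_0^t ∫_B (C_{k,k+1} u_{k+1}(τ))(Φ^k_τ Y) dY dτ`.
The input (H1) of `TaggedSphereContactTrace.bgsr_linearBoltzmannApprox_of_H1` /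
`TaggedSphereOneStepInputs` is the same identity ALMOST EVERYWHERE in transport form,
`u_k(t) = S_k(t) u_k(0) + ∫_0^t S_k(t-τ) C_{k,k+1} u_{k+1}(τ) dτ` a.e.
This file proves the passage from the former to the latter for the regularised hard-sphere
hierarchy model `hsHierarchyModel` on `T^d` (`0 < ε < 1/2`) and Lanford-class families
vanishing off the hard-sphere domains (as marginal families do):

* `integral_op_regFlow_eq` — reading the Duhamel source along the flow:
  `∫_0^t (C u(τ))(Φ_τ Y) dτ = (∫_0^t S(t-τ) C u(τ) dτ)(Φ_t Y)` (group law of `regFlow`);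
* `hs_oneStep_ae_of_weak` — the passage: test sets `B ⊆ good ∩ {H ≤ E}` suffice; the defect
  `F = u_k(t) ∘ Φ_t - u_k(0) - D_t ∘ Φ_t` is Gaussian-bounded, has zero integral on every such
  `B`, hence vanishes a.e. on the good set (`Integrable.ae_eq_zero_of_forall_setIntegral_eq_zero`
  on the finite-energy shells); the identity at `Z` is the vanishing of `F` at `Φ_{-t} Z`
  (Lebesgue measure is preserved by `Φ_{-t}`, `measurePreserving_regFlow_volume`), and off the
  domain both sides vanish (`outBbgkyOp_eq_zero_of_not_mem`);
* `hs_oneStep_ae_of_weak_outer`, `hs_oneStep_ae_of_weak_image` — the same with the time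
  integral outside (Fubini against the Gaussian dominator) and with the test set transported
  instead of the integrand (`∫_{Φ_τ B} g = ∫_B g ∘ Φ_τ`, `HardSphereFlow.setIntegral_image_flow_eq`),
  the two shapes in which the weak identity is produced;
* `bgsr_oneStep_of_weak_image` and the reductions `bgsr_linearBoltzmannApprox_of_weakBBGKY`,
  `bodineau_gallagher_saintRaymond_linear_of_weakBBGKY`: BGSR's Theorem 2.2 (2.9) and its
  `α = 1` form follow from the weak one-step identity for the honest marginals
  `bgsrMarginalFamily` at the physical levels `1 ≤ k ≤ N`, for all `t > 0` and all measurable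
  test sets `B ⊆ good_k` of bounded energy.

Theorems only; no definition and no named fact is introduced.

## References

* C. Cercignani, R. Illner, M. Pulvirenti, *The Mathematical Theory of Dilute Gases*, Springer
  (1994), §4.3 (4.3.9)–(4.3.10), Thm 4.3.1, App. 4.B.
* T. Bodineau, I. Gallagher, L. Saint-Raymond, Invent. Math. 203 (2016) 493–553,
  arXiv:1305.3397v2, §3.1 p. 9, (4.3) p. 11.
-/

open MeasureTheory MeasureTheory.Measure Metric Real Set Filter Function Topology
open scoped ENNReal
open Literature.Analysis.FluidPDE

namespace Literature.MathematicalPhysics.KineticTheory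

noncomputable section

set_option synthInstance.maxSize 1024

variable {d : Type*} [Fintype d]

/-! ## §1. The passage weak ⇒ almost everywhere for the hard-sphere hierarchy model -/

section Weak

variable {ε : ℝ} (hε : 0 < ε) (hε' : ε < 2⁻¹) (Ntot : ℕ)

omit [Fintype d] in
/-- Measurability of `(τ, Z) ↦ (C_s u(τ))(Z)` for a jointly measurable family `u` (the field
`measurable_op` of a hierarchy model, with the family curried). [folklore] -/
theorem _root_.Literature.MathematicalPhysics.KineticTheory.HierarchyModel.measurable_op_curry [Fintype d]
    {X : Type*} [MeasurableSpace X] (M : HierarchyModel d X) (s : ℕ) {u : ℝ → Config (s + 1) d X → ℝ}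
    (hu : Measurable fun p : ℝ × Config (s + 1) d X => u p.1 p.2) :
    Measurable fun p : ℝ × Config s d X => M.op s (u p.1) p.2 :=
  M.measurable_op s hu

/-- **Reading the Duhamel source along the flow**: by the group law of the regularised flow,
`∫_0^t (C u(τ))(Φ_τ Y) dτ = (∫_0^t S(t-τ) C u(τ) dτ)(Φ_t Y)`. [folklore] -/
theorem integral_op_regFlow_eq {k : ℕ} (u : ℝ → Config (k + 1) d (UnitAddTorus d) → ℝ) (t : ℝ)
    (Y : Config k d (UnitAddTorus d)) :
    ∫ τ in (0 : ℝ)..t, (hsHierarchyModel (d := d) hε hε' Ntot).op k (u τ) (Alexander.regFlow (Torus.geometry d) ε τ Y) =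
      ∫ τ in (0 : ℝ)..t, (hsHierarchyModel (d := d) hε hε' Ntot).transport k (t - τ)
        ((hsHierarchyModel (d := d) hε hε' Ntot).op k (u τ)) (Alexander.regFlow (Torus.geometry d) ε t Y) := by
  refine intervalIntegral.integral_congr fun τ _ => ?_
  rw [hsHierarchyModel_transport_apply, ← Alexander.regFlow_add hε hε']
  congr 2
  ring

include hε' in
/-- The finite-energy shells `{H ≤ E}` of the phase space over the torus have finite Lebesgue
measure (the Gaussian `e^{-H}` is integrable and bounded below there). [folklore] -/
theorem volume_setOf_configEnergy_le_lt_top {k : ℕ} (E : ℝ) :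
    volume {Z : Config k d (UnitAddTorus d) | configEnergy Z ≤ E} < ∞ := by
  have _ := hε'
  have hi := integrable_exp_neg_mul_configEnergy (d := d) (n := k) (b := 1) one_pos
  have h := hi.measure_ge_lt_top (ε := Real.exp (-1 * E)) (Real.exp_pos _)
  refine lt_of_le_of_lt (measure_mono fun Z hZ => ?_) h
  simp only [mem_setOf_eq] at hZ ⊢
  exact Real.exp_le_exp.2 (by nlinarith)

include hε hε' in
/-- **The one-step hierarchy almost everywhere from its weak form along the flow** (regularised
hard-sphere hierarchy model on `T^d`, `0 < ε < 1/2`). Let `u_k`, `u_{k+1}` be Lanford-class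
time-dependent densities on `[0, T]` vanishing off the hard-sphere domains, `t ∈ [0, T]`, and
suppose that for every `E` and every measurable `B ⊆ good_k ∩ {H ≤ E}`,
`∫_B u_k(t, Φ_t Y) dY - ∫_B u_k(0, Y) dY = ∫_B ∫_0^t (C_{k,k+1} u_{k+1}(τ))(Φ_τ Y) dτ dY`.
Then `u_k(t) = S_k(t) u_k(0) + ∫_0^t S_k(t-τ) C_{k,k+1} u_{k+1}(τ) dτ` almost everywhere.
[cite: CIP1994, Thm 4.3.1 (4.3.10)] -/
theorem hs_oneStep_ae_of_weak {k : ℕ} {T : ℝ} {uk : ℝ → Config k d (UnitAddTorus d) → ℝ}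
    {uk1 : ℝ → Config (k + 1) d (UnitAddTorus d) → ℝ} (huk : IsNiceT T uk) (huk1 : IsNiceT T uk1)
    (huk0 : ∀ (τ : ℝ) (Z : Config k d (UnitAddTorus d)), Z ∉ hardSphereDomain (Torus.geometry d) k ε → uk τ Z = 0)
    (huk10 : ∀ (τ : ℝ) (W : Config (k + 1) d (UnitAddTorus d)),
      W ∉ hardSphereDomain (Torus.geometry d) (k + 1) ε → uk1 τ W = 0)
    {t : ℝ} (ht : t ∈ Icc 0 T)
    (hweak : ∀ (E : ℝ) (B : Set (Config k d (UnitAddTorus d))), MeasurableSet B →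
      B ⊆ Alexander.good (Torus.geometry d) ε → B ⊆ {Z | configEnergy Z ≤ E} →
      (∫ Y in B, uk t (Alexander.regFlow (Torus.geometry d) ε t Y)) - ∫ Y in B, uk 0 Y =
        ∫ Y in B, ∫ τ in (0 : ℝ)..t,
          (hsHierarchyModel (d := d) hε hε' Ntot).op k (uk1 τ) (Alexander.regFlow (Torus.geometry d) ε τ Y)) :
    ∀ᵐ Z : Config k d (UnitAddTorus d),
      uk t Z = (hsHierarchyModel (d := d) hε hε' Ntot).transport k t (uk 0) Z +
        ∫ τ in (0 : ℝ)..t, (hsHierarchyModel (d := d) hε hε' Ntot).transport k (t - τ)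
          ((hsHierarchyModel (d := d) hε hε' Ntot).op k (uk1 τ)) Z := by
  have hG := Torus.isHardSphereRegular_geometry (d := d) hε'
  have hGm := Torus.isMeasurable_geometry (d := d)
  have hgoodm : MeasurableSet (Alexander.good (Torus.geometry d) ε : Set (Config k d (UnitAddTorus d))) :=
    Alexander.measurableSet_good hG hGm
  have h0T : (0 : ℝ) ∈ Icc 0 T := ⟨le_rfl, ht.1.trans ht.2⟩
  -- the Duhamel step `D` and the defect `F`
  have hDnice : IsNiceT T (fun t' Z => ∫ τ in (0 : ℝ)..t', (hsHierarchyModel (d := d) hε hε' Ntot).transport k (t' - τ)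
      ((hsHierarchyModel (d := d) hε hε' Ntot).op k (uk1 τ)) Z) :=
    isNiceT_duhamelStep _ huk1
  set D : Config k d (UnitAddTorus d) → ℝ := fun Z => ∫ τ in (0 : ℝ)..t,
    (hsHierarchyModel (d := d) hε hε' Ntot).transport k (t - τ) ((hsHierarchyModel (d := d) hε hε' Ntot).op k (uk1 τ)) Z with hD
  set F : Config k d (UnitAddTorus d) → ℝ := fun Y =>
    uk t (Alexander.regFlow (Torus.geometry d) ε t Y) - uk 0 Y - D (Alexander.regFlow (Torus.geometry d) ε t Y) with hF
  -- measurability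
  have hukm : ∀ s : ℝ, Measurable (uk s) := fun s => huk.measurable.comp (measurable_const.prodMk measurable_id)
  have hDm : Measurable D := (hDnice.isNice ht).1
  have hflm : Measurable (Alexander.regFlow (N := k) (Torus.geometry d) ε t) := Alexander.measurable_regFlow hε' t
  have hFm : Measurable F := (((hukm t).comp hflm).sub (hukm 0)).sub (hDm.comp hflm)
  -- Gaussian bound, integrability
  obtain ⟨K, b, hK, hb, hKb⟩ := huk.exists_nonneg
  obtain ⟨K', b', hK', hb', hKb'⟩ := hDnice.exists_nonneg
  set b₀ : ℝ := min b b' with hb₀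
  have hb₀pos : 0 < b₀ := lt_min hb hb'
  have hexp_le : ∀ {c : ℝ}, b₀ ≤ c → ∀ Z : Config k d (UnitAddTorus d),
      Real.exp (-c * configEnergy Z) ≤ Real.exp (-b₀ * configEnergy Z) := by
    intro c hc Z
    have hH : 0 ≤ configEnergy Z := configEnergy_nonneg' Z
    exact Real.exp_le_exp.2 (by nlinarith)
  have hFb : ∀ Y, |F Y| ≤ (K + K + K') * Real.exp (-b₀ * configEnergy Y) := by
    intro Y
    have h1 := hKb t ht (Alexander.regFlow (Torus.geometry d) ε t Y)
    have h2 := hKb 0 h0T Y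
    have h3 := hKb' t ht (Alexander.regFlow (Torus.geometry d) ε t Y)
    rw [Alexander.configEnergy_regFlow] at h1 h3
    have e1 := hexp_le (min_le_left b b') Y
    have e3 := hexp_le (min_le_right b b') Y
    have h1' := h1.trans (mul_le_mul_of_nonneg_left e1 hK)
    have h2' := h2.trans (mul_le_mul_of_nonneg_left e1 hK)
    have h3' := h3.trans (mul_le_mul_of_nonneg_left e3 hK')
    have htri1 := abs_sub (uk t (Alexander.regFlow (Torus.geometry d) ε t Y) - uk 0 Y)
      (D (Alexander.regFlow (Torus.geometry d) ε t Y))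
    have htri2 := abs_sub (uk t (Alexander.regFlow (Torus.geometry d) ε t Y)) (uk 0 Y)
    have hFY : F Y = uk t (Alexander.regFlow (Torus.geometry d) ε t Y) - uk 0 Y -
        D (Alexander.regFlow (Torus.geometry d) ε t Y) := rfl
    rw [hFY]
    linarith
  have hFi : Integrable F := by
    refine Integrable.mono' ((integrable_exp_neg_mul_configEnergy hb₀pos).const_mul (K + K + K'))
      hFm.aestronglyMeasurable (Filter.Eventually.of_forall fun Y => ?_)
    rw [Real.norm_eq_abs]
    exact hFb Y
  -- zero integral on the test sets
  have hzero : ∀ (E : ℝ) (B : Set (Config k d (UnitAddTorus d))), MeasurableSet B →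
      B ⊆ Alexander.good (Torus.geometry d) ε → B ⊆ {Z | configEnergy Z ≤ E} → ∫ Y in B, F Y = 0 := by
    intro E B hB hBg hBE
    have hw := hweak E B hB hBg hBE
    have hi1 : IntegrableOn (fun Y => uk t (Alexander.regFlow (Torus.geometry d) ε t Y)) B := by
      refine (Integrable.mono' ((integrable_exp_neg_mul_configEnergy hb).const_mul K)
        ((hukm t).comp hflm).aestronglyMeasurable (Filter.Eventually.of_forall fun Y => ?_)).integrableOn
      have h1 := hKb t ht (Alexander.regFlow (Torus.geometry d) ε t Y)
      rw [Alexander.configEnergy_regFlow] at h1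
      rwa [Real.norm_eq_abs]
    have hi2 : IntegrableOn (uk 0) B := by
      refine (Integrable.mono' ((integrable_exp_neg_mul_configEnergy hb).const_mul K)
        (hukm 0).aestronglyMeasurable (Filter.Eventually.of_forall fun Y => ?_)).integrableOn
      rw [Real.norm_eq_abs]; exact hKb 0 h0T Y
    have hi3 : IntegrableOn (fun Y => D (Alexander.regFlow (Torus.geometry d) ε t Y)) B := by
      refine (Integrable.mono' ((integrable_exp_neg_mul_configEnergy hb').const_mul K')
        (hDm.comp hflm).aestronglyMeasurable (Filter.Eventually.of_forall fun Y => ?_)).integrableOn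
      have h3 := hKb' t ht (Alexander.regFlow (Torus.geometry d) ε t Y)
      rw [Alexander.configEnergy_regFlow] at h3
      rwa [Real.norm_eq_abs]
    have hD_eq : ∫ Y in B, D (Alexander.regFlow (Torus.geometry d) ε t Y) =
        ∫ Y in B, ∫ τ in (0 : ℝ)..t,
          (hsHierarchyModel (d := d) hε hε' Ntot).op k (uk1 τ) (Alexander.regFlow (Torus.geometry d) ε τ Y) := by
      refine setIntegral_congr_fun hB fun Y _ => ?_
      rw [hD]
      exact (integral_op_regFlow_eq hε hε' Ntot uk1 t Y).symm
    have h12 : IntegrableOn (fun Y => uk t (Alexander.regFlow (Torus.geometry d) ε t Y) - uk 0 Y) B := hi1.sub hi2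
    have hsplit : ∫ Y in B, F Y = ((∫ Y in B, uk t (Alexander.regFlow (Torus.geometry d) ε t Y)) - ∫ Y in B, uk 0 Y) -
        ∫ Y in B, D (Alexander.regFlow (Torus.geometry d) ε t Y) := by
      rw [← integral_sub hi1 hi2, ← integral_sub h12 hi3]
    rw [hsplit, hw, hD_eq, sub_self]
  -- `F = 0` almost everywhere on the good set
  have hae_good : ∀ᵐ Y : Config k d (UnitAddTorus d), Y ∈ Alexander.good (Torus.geometry d) ε → F Y = 0 := by
    have hshell : ∀ n : ℕ, ∀ᵐ Y : Config k d (UnitAddTorus d),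
        Y ∈ Alexander.good (Torus.geometry d) ε ∩ {Z | configEnergy Z ≤ (n : ℝ)} → F Y = 0 := by
      intro n
      have hSm : MeasurableSet (Alexander.good (Torus.geometry d) ε ∩ {Z : Config k d (UnitAddTorus d) | configEnergy Z ≤ (n : ℝ)}) :=
        hgoodm.inter (measurableSet_le (measurable_configEnergy' k) measurable_const)
      have h := (hFi.restrict (s := Alexander.good (Torus.geometry d) ε ∩ {Z | configEnergy Z ≤ (n : ℝ)})).ae_eq_zero_of_forall_setIntegral_eq_zero
        (fun s hs _ => by
          rw [Measure.restrict_restrict hs]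
          exact hzero n _ (hs.inter hSm) (fun Y hY => hY.2.1) (fun Y hY => hY.2.2))
      rw [Filter.EventuallyEq, ae_restrict_iff' hSm] at h
      exact h
    rw [← ae_all_iff] at hshell
    filter_upwards [hshell] with Y hY hYg
    obtain ⟨n, hn⟩ := exists_nat_ge (configEnergy Y)
    exact hY n ⟨hYg, hn⟩
  -- on the domain, almost every configuration is good
  have hae_dom : ∀ᵐ Y : Config k d (UnitAddTorus d), Y ∈ hardSphereDomain (Torus.geometry d) k ε →
      Y ∈ Alexander.good (Torus.geometry d) ε := by
    have h := (Alexander.regHardSphereFlow (d := d) hε hε' k).ae_mem_good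
    rw [liouville_eq, ae_restrict_iff' (measurableSet_hardSphereDomain _ Torus.measurable_geometry_sepVec k ε)] at h
    exact h
  have hae : ∀ᵐ Y : Config k d (UnitAddTorus d), Y ∈ hardSphereDomain (Torus.geometry d) k ε → F Y = 0 := by
    filter_upwards [hae_good, hae_dom] with Y h1 h2 hY
    exact h1 (h2 hY)
  -- pull back along `Φ_{-t}`
  have hmp := measurePreserving_regFlow_volume (d := d) hε hε' (N := k) (-t)
  have hpull := hmp.quasiMeasurePreserving.ae hae
  filter_upwards [hpull, hae_dom] with Z hZ hZdom
  by_cases hZD : Z ∈ hardSphereDomain (Torus.geometry d) k ε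
  · have hZg : Z ∈ Alexander.good (Torus.geometry d) ε := hZdom hZD
    have hYg := Alexander.mapsTo_regFlow_good hε hε' (-t) hZg
    have h := hZ (Alexander.good_subset_hardSphereDomain hYg)
    have hback : Alexander.regFlow (Torus.geometry d) ε t (Alexander.regFlow (Torus.geometry d) ε (-t) Z) = Z := by
      rw [← Alexander.regFlow_add hε hε', add_neg_cancel, Alexander.regFlow_zero hε hε']
    simp only [hF, hback] at h
    rw [hsHierarchyModel_transport_apply]
    linarith
  · -- off the domain both sides vanish
    have hZg : Z ∉ Alexander.good (Torus.geometry d) ε := fun h => hZD (Alexander.good_subset_hardSphereDomain h)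
    have hint : ∫ τ in (0 : ℝ)..t, (hsHierarchyModel (d := d) hε hε' Ntot).transport k (t - τ)
        ((hsHierarchyModel (d := d) hε hε' Ntot).op k (uk1 τ)) Z = 0 := by
      refine intervalIntegral.integral_zero_ae (Filter.Eventually.of_forall fun τ _ => ?_)
      rw [hsHierarchyModel_transport_apply, Alexander.regFlow_of_not_mem hZg, hsHierarchyModel_op]
      exact outBbgkyOp_eq_zero_of_not_mem Ntot (huk10 τ) hZD
    rw [hint, hsHierarchyModel_transport_apply, Alexander.regFlow_of_not_mem hZg, huk0 t Z hZD, huk0 0 Z hZD, add_zero]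

include hε hε' in
/-- **The passage with the time integral outside** (the shape of CIP (4.3.9) integrated in time):
it suffices that for every `E` and every measurable `B ⊆ good_k ∩ {H ≤ E}`,
`∫_B u_k(t, Φ_t Y) dY - ∫_B u_k(0, Y) dY = ∫_{(0,t]} ∫_B (C_{k,k+1} u_{k+1}(τ))(Φ_τ Y) dY dτ`
(Fubini against the Gaussian dominator of `abs_op_le`). [cite: CIP1994, Thm 4.3.1 (4.3.9)] -/
theorem hs_oneStep_ae_of_weak_outer {k : ℕ} {T : ℝ} {uk : ℝ → Config k d (UnitAddTorus d) → ℝ}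
    {uk1 : ℝ → Config (k + 1) d (UnitAddTorus d) → ℝ} (huk : IsNiceT T uk) (huk1 : IsNiceT T uk1)
    (huk0 : ∀ (τ : ℝ) (Z : Config k d (UnitAddTorus d)), Z ∉ hardSphereDomain (Torus.geometry d) k ε → uk τ Z = 0)
    (huk10 : ∀ (τ : ℝ) (W : Config (k + 1) d (UnitAddTorus d)),
      W ∉ hardSphereDomain (Torus.geometry d) (k + 1) ε → uk1 τ W = 0)
    {t : ℝ} (ht : t ∈ Icc 0 T)
    (hweak : ∀ (E : ℝ) (B : Set (Config k d (UnitAddTorus d))), MeasurableSet B →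
      B ⊆ Alexander.good (Torus.geometry d) ε → B ⊆ {Z | configEnergy Z ≤ E} →
      (∫ Y in B, uk t (Alexander.regFlow (Torus.geometry d) ε t Y)) - ∫ Y in B, uk 0 Y =
        ∫ τ in Ioc (0 : ℝ) t, ∫ Y in B,
          (hsHierarchyModel (d := d) hε hε' Ntot).op k (uk1 τ) (Alexander.regFlow (Torus.geometry d) ε τ Y)) :
    ∀ᵐ Z : Config k d (UnitAddTorus d),
      uk t Z = (hsHierarchyModel (d := d) hε hε' Ntot).transport k t (uk 0) Z +
        ∫ τ in (0 : ℝ)..t, (hsHierarchyModel (d := d) hε hε' Ntot).transport k (t - τ)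
          ((hsHierarchyModel (d := d) hε hε' Ntot).op k (uk1 τ)) Z := by
  refine hs_oneStep_ae_of_weak hε hε' Ntot huk huk1 huk0 huk10 ht fun E B hB hBg hBE => ?_
  rw [hweak E B hB hBg hBE]
  -- Fubini for the bounded measurable integrand `(τ, Y) ↦ (C u(τ))(Φ_τ Y)` on `(0,t] × B`
  have hopm : Measurable fun q : ℝ × Config k d (UnitAddTorus d) =>
      (hsHierarchyModel (d := d) hε hε' Ntot).op k (uk1 q.1) q.2 :=
    (hsHierarchyModel (d := d) hε hε' Ntot).measurable_op_curry k huk1.measurable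
  have hgm : Measurable fun q : ℝ × Config k d (UnitAddTorus d) =>
      (hsHierarchyModel (d := d) hε hε' Ntot).op k (uk1 q.1) (Alexander.regFlow (Torus.geometry d) ε q.1 q.2) := by
    have h := hopm.comp (measurable_fst.prodMk (Alexander.measurable_regFlow_uncurry (N := k) hε'))
    simpa only [Function.comp_def] using h
  obtain ⟨K, b, hK, hb, hKb⟩ := huk1.exists_nonneg
  obtain ⟨A, hA⟩ : ∃ A : ℝ, ∀ τ ∈ Icc (0 : ℝ) T, ∀ Y : Config k d (UnitAddTorus d),
      |(hsHierarchyModel (d := d) hε hε' Ntot).op k (uk1 τ) Y| ≤ A * Real.exp (-(b / 2) * configEnergy Y) :=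
    ⟨_, fun τ hτ Y => (hsHierarchyModel (d := d) hε hε' Ntot).abs_op_le k hb hK (hKb τ hτ) Y⟩
  have hbound : ∀ τ ∈ Ioc (0 : ℝ) t, ∀ Y : Config k d (UnitAddTorus d),
      |(hsHierarchyModel (d := d) hε hε' Ntot).op k (uk1 τ) (Alexander.regFlow (Torus.geometry d) ε τ Y)| ≤
        A * Real.exp (-(b / 2) * configEnergy Y) := by
    intro τ hτ Y
    have h := hA τ ⟨hτ.1.le, hτ.2.trans ht.2⟩ (Alexander.regFlow (Torus.geometry d) ε τ Y)
    rwa [Alexander.configEnergy_regFlow] at h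
  haveI hfin : IsFiniteMeasure ((volume : Measure ℝ).restrict (Ioc 0 t)) := ⟨by
    rw [Measure.restrict_apply_univ]; exact measure_Ioc_lt_top⟩
  have hdom : Integrable (fun q : ℝ × Config k d (UnitAddTorus d) => (1 : ℝ) * (A * Real.exp (-(b / 2) * configEnergy q.2)))
      (((volume : Measure ℝ).restrict (Ioc 0 t)).prod ((volume : Measure (Config k d (UnitAddTorus d))).restrict B)) :=
    (integrable_const (1 : ℝ)).mul_prod (((integrable_exp_neg_mul_configEnergy (half_pos hb)).const_mul A).integrableOn)
  have hq : ∀ᵐ q : ℝ × Config k d (UnitAddTorus d) ∂(((volume : Measure ℝ).restrict (Ioc 0 t)).prod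
      ((volume : Measure (Config k d (UnitAddTorus d))).restrict B)), q.1 ∈ Ioc (0 : ℝ) t :=
    Measure.quasiMeasurePreserving_fst.ae (ae_restrict_mem measurableSet_Ioc)
  have hprod : Integrable (fun q : ℝ × Config k d (UnitAddTorus d) =>
      (hsHierarchyModel (d := d) hε hε' Ntot).op k (uk1 q.1) (Alexander.regFlow (Torus.geometry d) ε q.1 q.2))
      (((volume : Measure ℝ).restrict (Ioc 0 t)).prod ((volume : Measure (Config k d (UnitAddTorus d))).restrict B)) := by
    refine hdom.mono' hgm.aestronglyMeasurable (hq.mono fun q hq1 => ?_)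
    rw [one_mul, Real.norm_eq_abs]
    exact hbound q.1 hq1 q.2
  have hprod' : Integrable (Function.uncurry fun (τ : ℝ) (Y : Config k d (UnitAddTorus d)) =>
      (hsHierarchyModel (d := d) hε hε' Ntot).op k (uk1 τ) (Alexander.regFlow (Torus.geometry d) ε τ Y))
      (((volume : Measure ℝ).restrict (Ioc 0 t)).prod ((volume : Measure (Config k d (UnitAddTorus d))).restrict B)) := by
    simpa only [Function.uncurry_def] using hprod
  rw [integral_integral_swap hprod']
  refine setIntegral_congr_fun hB fun Y _ => ?_
  exact (intervalIntegral.integral_of_le ht.1).symm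

include hε hε' in
/-- **The passage with the test set transported** (the shape produced by the flux computation,
`∫ 1_{Φ_τ B} · C_{k,k+1} u_{k+1}(τ)`): it suffices that for every `E` and every measurable
`B ⊆ good_k ∩ {H ≤ E}`,
`∫_B u_k(t, Φ_t Y) dY - ∫_B u_k(0, Y) dY = ∫_{(0,t]} ∫_{Φ_τ B} (C_{k,k+1} u_{k+1}(τ))(X) dX dτ`
(Liouville substitution `HardSphereFlow.setIntegral_image_flow_eq`). [cite: CIP1994, Thm 4.3.1 (4.3.9)] -/
theorem hs_oneStep_ae_of_weak_image {k : ℕ} {T : ℝ} {uk : ℝ → Config k d (UnitAddTorus d) → ℝ}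
    {uk1 : ℝ → Config (k + 1) d (UnitAddTorus d) → ℝ} (huk : IsNiceT T uk) (huk1 : IsNiceT T uk1)
    (huk0 : ∀ (τ : ℝ) (Z : Config k d (UnitAddTorus d)), Z ∉ hardSphereDomain (Torus.geometry d) k ε → uk τ Z = 0)
    (huk10 : ∀ (τ : ℝ) (W : Config (k + 1) d (UnitAddTorus d)),
      W ∉ hardSphereDomain (Torus.geometry d) (k + 1) ε → uk1 τ W = 0)
    {t : ℝ} (ht : t ∈ Icc 0 T)
    (hweak : ∀ (E : ℝ) (B : Set (Config k d (UnitAddTorus d))), MeasurableSet B →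
      B ⊆ Alexander.good (Torus.geometry d) ε → B ⊆ {Z | configEnergy Z ≤ E} →
      (∫ Y in B, uk t (Alexander.regFlow (Torus.geometry d) ε t Y)) - ∫ Y in B, uk 0 Y =
        ∫ τ in Ioc (0 : ℝ) t, ∫ X in Alexander.regFlow (Torus.geometry d) ε τ '' B,
          (hsHierarchyModel (d := d) hε hε' Ntot).op k (uk1 τ) X) :
    ∀ᵐ Z : Config k d (UnitAddTorus d),
      uk t Z = (hsHierarchyModel (d := d) hε hε' Ntot).transport k t (uk 0) Z +
        ∫ τ in (0 : ℝ)..t, (hsHierarchyModel (d := d) hε hε' Ntot).transport k (t - τ)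
          ((hsHierarchyModel (d := d) hε hε' Ntot).op k (uk1 τ)) Z := by
  refine hs_oneStep_ae_of_weak_outer hε hε' Ntot huk huk1 huk0 huk10 ht fun E B hB hBg hBE => ?_
  rw [hweak E B hB hBg hBE]
  have hopm : Measurable fun q : ℝ × Config k d (UnitAddTorus d) =>
      (hsHierarchyModel (d := d) hε hε' Ntot).op k (uk1 q.1) q.2 :=
    (hsHierarchyModel (d := d) hε hε' Ntot).measurable_op_curry k huk1.measurable
  refine setIntegral_congr_fun measurableSet_Ioc fun τ _ => ?_
  have hgτ : Measurable ((hsHierarchyModel (d := d) hε hε' Ntot).op k (uk1 τ)) := by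
    have h := hopm.comp (measurable_prodMk_left (x := τ))
    simpa only [Function.comp_def] using h
  exact (Alexander.regHardSphereFlow (d := d) hε hε' k).setIntegral_image_flow_eq τ hB hBg hgτ

end Weak

/-! ## §2. BGSR's marginals: the named facts from the weak one-step identity -/

section BGSR

variable {ε : ℝ} (hε : 0 < ε) (hε' : ε < 2⁻¹) (N : ℕ) (β : ℝ) (ρ₀ : UnitAddTorus d → ℝ)

/-- **(H1) at a physical level from the weak one-step identity** for BGSR's honest marginals
`f_N^{(k)} = bgsrMarginalFamily … k` (regime `N(2ε)^d ≤ 1/2`, `β > 0`, measurable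
`0 ≤ ρ⁰ ≤ R`): if for every `E` and every measurable `B ⊆ good_k ∩ {H ≤ E}`
`∫_B f^{(k)}(t, Φ_t Y) dY - ∫_B f^{(k)}(0, Y) dY = ∫_{(0,t]} ∫_{Φ_τ B} (C_{k,k+1} f^{(k+1)}(τ)) dτ`,
then the one-step identity holds a.e. at level `k` and time `t ≥ 0`.
[cite: BodineauGallagherSaintRaymondInvent2016, (4.3) p. 11] -/
theorem bgsr_oneStep_of_weak_image (hβ : 0 < β) (hρ₀m : Measurable ρ₀) {R : ℝ} (hρ₀0 : ∀ x, 0 ≤ ρ₀ x)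
    (hR : ∀ x, ρ₀ x ≤ R) (hN : (N : ℝ) * (2 * ε) ^ Fintype.card d ≤ 2⁻¹) (k : ℕ) {t : ℝ} (ht : 0 ≤ t)
    (hweak : ∀ (E : ℝ) (B : Set (Config k d (UnitAddTorus d))), MeasurableSet B →
      B ⊆ Alexander.good (Torus.geometry d) ε → B ⊆ {Z | configEnergy Z ≤ E} →
      (∫ Y in B, bgsrMarginalFamily hε hε' N β ρ₀ k t (Alexander.regFlow (Torus.geometry d) ε t Y)) -
          ∫ Y in B, bgsrMarginalFamily hε hε' N β ρ₀ k 0 Y =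
        ∫ τ in Ioc (0 : ℝ) t, ∫ X in Alexander.regFlow (Torus.geometry d) ε τ '' B,
          (hsHierarchyModel (d := d) hε hε' (N + 1)).op k (bgsrMarginalFamily hε hε' N β ρ₀ (k + 1) τ) X) :
    ∀ᵐ Z : Config k d (UnitAddTorus d),
      bgsrMarginalFamily hε hε' N β ρ₀ k t Z =
        (hsHierarchyModel (d := d) hε hε' (N + 1)).transport k t (bgsrMarginalFamily hε hε' N β ρ₀ k 0) Z +
          ∫ τ in (0 : ℝ)..t, (hsHierarchyModel (d := d) hε hε' (N + 1)).transport k (t - τ)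
            ((hsHierarchyModel (d := d) hε hε' (N + 1)).op k (bgsrMarginalFamily hε hε' N β ρ₀ (k + 1) τ)) Z :=
  hs_oneStep_ae_of_weak_image hε hε' (N + 1) (T := t)
    (isNiceT_bgsrMarginalFamily hε hε' N β ρ₀ hβ hρ₀m hρ₀0 hR hN k t)
    (isNiceT_bgsrMarginalFamily hε hε' N β ρ₀ hβ hρ₀m hρ₀0 hR hN (k + 1) t)
    (fun τ _ hZ => bgsrMarginalFamily_eq_zero_of_not_mem hε hε' N β ρ₀ k τ hZ)
    (fun τ _ hW => bgsrMarginalFamily_eq_zero_of_not_mem hε hε' N β ρ₀ (k + 1) τ hW)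
    ⟨ht, le_rfl⟩ hweak

end BGSR

/-! ## §3. The named facts from the weak one-step identity at the physical levels -/

/-- **BGSR Theorem 2.2 (2.9) from the weak one-step BBGKY identity at the physical levels.**
In the regime `d ≥ 2`, `0 < ε < 1/2`, `N(2ε)^d ≤ 1/2`, `β > 0`, `ρ⁰` continuous with
`0 ≤ ρ⁰ ≤ R`, `∫ ρ⁰ = 1`, suppose that for every level `1 ≤ k ≤ N`, every `t > 0`, every `E`
and every measurable `B ⊆ good_k ∩ {H ≤ E}` the honest marginals
`f^{(k)} = bgsrMarginalFamily … k` of the `N + 1` hard spheres satisfy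
`∫_B f^{(k)}(t, Φ_t Y) dY - ∫_B f^{(k)}(0, Y) dY = ∫_{(0,t]} ∫_{Φ_τ B} C_{k,k+1} f^{(k+1)}(τ) dτ`
(CIP 1994 Thm 4.3.1 in weak form along the tagged flow). Then `bgsr_linearBoltzmannApprox`
holds: `bgsr_linearBoltzmannApprox_of_H1_phys` (`TaggedSphereOneStepLevels`) with (H1) at the
physical levels supplied by `bgsr_oneStep_of_weak_image` (`t = 0` being trivial).
[cite: BodineauGallagherSaintRaymondInvent2016, Thm 2.2 (2.9) p. 7; (4.3) p. 11] -/
theorem bgsr_linearBoltzmannApprox_of_weakBBGKY [DecidableEq d]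
    (hW : 2 ≤ Fintype.card d → ∀ (N : ℕ) (ε : ℝ) (hε : 0 < ε) (hε' : ε < 2⁻¹),
      (N : ℝ) * (2 * ε) ^ Fintype.card d ≤ 2⁻¹ →
      ∀ (β : ℝ), 0 < β → ∀ (R : ℝ) (ρ₀ : UnitAddTorus d → ℝ), Continuous ρ₀ → (∀ x, 0 ≤ ρ₀ x) →
      (∀ x, ρ₀ x ≤ R) → ∫ x, ρ₀ x = 1 →
        ∀ (k : ℕ), 1 ≤ k → k ≤ N → ∀ (t : ℝ), 0 < t →
        ∀ (E : ℝ) (B : Set (Config k d (UnitAddTorus d))), MeasurableSet B →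
          B ⊆ Alexander.good (Torus.geometry d) ε → B ⊆ {Z | configEnergy Z ≤ E} →
          (∫ Y in B, bgsrMarginalFamily hε hε' N β ρ₀ k t (Alexander.regFlow (Torus.geometry d) ε t Y)) -
              ∫ Y in B, bgsrMarginalFamily hε hε' N β ρ₀ k 0 Y =
            ∫ τ in Ioc (0 : ℝ) t, ∫ X in Alexander.regFlow (Torus.geometry d) ε τ '' B,
              (hsHierarchyModel (d := d) hε hε' (N + 1)).op k (bgsrMarginalFamily hε hε' N β ρ₀ (k + 1) τ) X) :
    bgsr_linearBoltzmannApprox (d := d) := by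
  refine bgsr_linearBoltzmannApprox_of_H1_phys fun hd N ε hε hε' hN β hβ R ρ₀ hc h0 hR h1 k hk1 hkN t ht => ?_
  rcases ht.eq_or_lt with rfl | htpos
  · -- `t = 0`: both sides are `f^{(k)}(0, Z)`
    refine ae_of_all _ fun Z => ?_
    rw [intervalIntegral.integral_same, add_zero, hsHierarchyModel_transport_apply, neg_zero,
      Alexander.regFlow_zero hε hε']
  · exact bgsr_oneStep_of_weak_image hε hε' N β ρ₀ hβ hc.measurable h0 hR hN k htpos.le
      (hW hd N ε hε hε' hN β hβ R ρ₀ hc h0 hR h1 k hk1 hkN t htpos)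

/-- **Fact (c) `bodineau_gallagher_saintRaymond_linear` from the weak one-step BBGKY identity at
the physical levels** (same hypothesis as `bgsr_linearBoltzmannApprox_of_weakBBGKY`):
`bodineau_gallagher_saintRaymond_linear_of_H1_phys` with (H1) from `bgsr_oneStep_of_weak_image`.
[cite: BodineauGallagherSaintRaymondInvent2016, Thm 2.2 p. 7; (4.3) p. 11] -/
theorem bodineau_gallagher_saintRaymond_linear_of_weakBBGKY [DecidableEq d]
    (hW : 2 ≤ Fintype.card d → ∀ (N : ℕ) (ε : ℝ) (hε : 0 < ε) (hε' : ε < 2⁻¹),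
      (N : ℝ) * (2 * ε) ^ Fintype.card d ≤ 2⁻¹ →
      ∀ (β : ℝ), 0 < β → ∀ (R : ℝ) (ρ₀ : UnitAddTorus d → ℝ), Continuous ρ₀ → (∀ x, 0 ≤ ρ₀ x) →
      (∀ x, ρ₀ x ≤ R) → ∫ x, ρ₀ x = 1 →
        ∀ (k : ℕ), 1 ≤ k → k ≤ N → ∀ (t : ℝ), 0 < t →
        ∀ (E : ℝ) (B : Set (Config k d (UnitAddTorus d))), MeasurableSet B →
          B ⊆ Alexander.good (Torus.geometry d) ε → B ⊆ {Z | configEnergy Z ≤ E} →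
          (∫ Y in B, bgsrMarginalFamily hε hε' N β ρ₀ k t (Alexander.regFlow (Torus.geometry d) ε t Y)) -
              ∫ Y in B, bgsrMarginalFamily hε hε' N β ρ₀ k 0 Y =
            ∫ τ in Ioc (0 : ℝ) t, ∫ X in Alexander.regFlow (Torus.geometry d) ε τ '' B,
              (hsHierarchyModel (d := d) hε hε' (N + 1)).op k (bgsrMarginalFamily hε hε' N β ρ₀ (k + 1) τ) X) :
    bodineau_gallagher_saintRaymond_linear (d := d) := by
  refine bodineau_gallagher_saintRaymond_linear_of_H1_phys fun hd N ε hε hε' hN β hβ R ρ₀ hc h0 hR h1 k hk1 hkN t ht => ?_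
  rcases ht.eq_or_lt with rfl | htpos
  · refine ae_of_all _ fun Z => ?_
    rw [intervalIntegral.integral_same, add_zero, hsHierarchyModel_transport_apply, neg_zero,
      Alexander.regFlow_zero hε hε']
  · exact bgsr_oneStep_of_weak_image hε hε' N β ρ₀ hβ hc.measurable h0 hR hN k htpos.le
      (hW hd N ε hε hε' hN β hβ R ρ₀ hc h0 hR h1 k hk1 hkN t htpos)

end

end Literature.MathematicalPhysics.KineticTheory
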